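import Summits.Schanuel.Schanuel.Theorems.RootDecomp1EWallDichotomy01

/-!
# RootDecomp1EUntwistedWall — lens 2, generation 41 «THE UNTWISTED 1-FOLD WALL BY TERM-COUNTING» (lane (P1) of critic RULING L1949 (5); GO + CHECKLIST E-g41 L1993; VERDICT L2040: CLEARED — ONE CELL (E-R18 (a″)) mod hE): `S` ITSELF with surplus one at the UNTWISTED twins `zTwin k β (q·ρ)` (`ρ` hyper-Liouville, `q ∈ ℚ^×`, `β ∈ ℚ(i) ∖ ℚ`, every `k ≥ 1`) and on the whole Gauss-curve class `InGaussCurveClass`, modulo the ONE registered published theorem `hE = EHLM2015_thm_2_1` (Ernvall-Hytönen–Leppälä–Matala-aho 2015, Thm 2.1, typed as a WEAKER few-term consequence over Gaussian-rational exponents) — «count TERMS, not DEGREE» — continuation (RootDecomp1EUntwistedWall01): §1 the registered fact `EHLM2015_thm_2_1` (`gι`, `lacEval`, `lacSize`) + §2 collapse data (`gaussPt`, `expo`, `coef`, `lacForm`, `FG`) + §3 identities (`FG_eq_aeval`, `lacEval_lacForm`) + §4 `exists_lipschitz_FG` + §5 distinct exponents, `fib_ne_zero`, TERM COUNT `ca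rd_support_lacForm_le`

(lens-2 g41 HOME kernel UntwistedWall.lean 8d50f5c1…, 1431 l, import tree `RootDecomp1EWallDichotomy01` ONLY; Ctrl 1a8646c2… rc 1 at exactly nine lines C1–C9; Probe 491b1be0…; NODE-g41.md ab32189b…; NODE L2035 / REQUEST L2036 / ERRATUM L2037; writer re-check L2039; critic VERDICT L2040 (crit g8): CLEARED — ONE CELL (E-R18 (a″)) to lens-2, conditional «mod hE»; lens-2 tally cells ×3; RULE E-R19; PORT GO 01–0k `--supports stmt-Schanuel-31409`, statements/proofs verbatim, part 01 docstring of `EHLM2015_thm_2_1` amended by the critic's representation sentence and the `+1 → +2` exponent bookkeeping.)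
PORTED for the decomp-schanuel cell by the census instrument (gen 17), no census credit beyond the cell of record. Split in five parts for the 400-line cap (NODE §7 plan 01–04 with §1–§8 halved): 01 = §1 the registered fact `EHLM2015_thm_2_1` (the ONLY `def … : Prop` binder) + §2–§5 collapse data / identities / Lipschitz bound / distinct exponents and term count; 02 = §6–§8 integrality, sizes, endgame; 03 = §9 THE ENGINE `algebraicIndependent_gaussPt` (+ the kernel's module docstring); 04 = §10–§11 twins, the class `InGaussCurveClass`, the cells `cell_25020` / `cell_31409`, the member `z_U` and its separation from the point / scale / two-scale classes; 05 = §12–§13 the hypothesis-free Diophantine lemma `lambdaH_ne_pow_of_dyadicHyper₂`, `not_inLWClass_zU`, `zU_separation`, and the LIVE-item probes at `z_U`.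
PORT EDITS (statements and proofs otherwise VERBATIM): every undocumented helper received a one-line docstring; the tree-twin one-liners `isAlgebraic_I'`, `I_not_mem_range'`, `lambdaH_transcendental`, `lambdaH_ne_zero'`, `lambdaH_pos'`, `algebraicIndependent_tail'`, `abs_pow_succ_sub_le'` made `private` (copied privately into later parts where used); the two `Iff.rfl` READ-BACKS `defectOneSchanuel_iff` / `eStableDefectOne_iff` of K §13 are NOT re-landed (identical read-backs are already in the tree: `RootDecomp1EGenericScale05.defectOneSchanuel_iff` / `.eStableDefectOne_iff`); the positional probes `item25020_at_zU`, `item31409_at_zU`, `cell_25020_of_defectOneSchanuel`, `eStableDefectOne_at_zU (h : EStableDefectOne)`, `eStableDefectOne_body_at_zU_of_hE` are kept. Items 31409 / 25020 / 31410 stay OPEN (rung 0); nothing here proves `S`.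
-/

noncomputable section

open Complex Polynomial IntermediateField
open scoped BigOperators

open Summit.Schanuel.Schanuel.Theorems.RootDecomp1KHyper (SB SFset exists_ball_eval_ne_zero
  exists_int_mul_eq_map mvaeval_int_map sb_of_algebraicIndependent mem_adjoin_SFset_I')
open Summit.Schanuel.Schanuel.Theorems.RootDecomp1KHyper.HyperCell (HyperLiouville lambdaH
  hyperLiouville_lambdaH hexp one_le_hexp summable_lambdaH)
open Summit.Schanuel.Schanuel.Theorems.RootDecomp1ELWTransport (zTwin zTwin_left zTwin_right
  linearIndependent_zTwin dblMoments InLWClass DyadicHyper₂)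
open Summit.Schanuel.Schanuel.Theorems.RootDecomp1EScaleTransfer (InScaleClass HyperScaleApprox)
open Summit.Schanuel.Schanuel.Theorems.RootDecomp1ETwoScale (CoveredTower InTwoScaleClass)
open Summit.Schanuel.Schanuel.Theorems.RootDecomp1EPointTransfer (InPointClass lambdaH_rat_lower
  lambdaH_sub_rat_lower)
open Summit.Schanuel.Schanuel.Theorems.RootDecomp1EWallDichotomy (InTwistedFrameClass transcendental_complex
  transcendental_of_hyperLiouville not_linearIndependent_zTwin_ratCast twinExpo twinExpo_left twinExpo_right)
open Summit.Schanuel.Schanuel.Theorems.RootDecomp1BHyperFrame (trdeg_adjoin_le_of_isAlgebraic')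
open Summit.Schanuel.Schanuel.Theorems.RootDecomp1BDefectFloorCells (natCast_le_trdeg_of_algebraicIndependent)

namespace Summit.Schanuel.Schanuel.Theorems.RootDecomp1EUntwistedWall

/-! ## §1  The registered print theorem (the ONLY `def … : Prop` input of this file) -/

/-- The Gaussian embedding `ℚ × ℚ → ℂ`, `(u, v) ↦ u + v·i` (so `ℚ × ℚ` is the field `𝕀 = ℚ(√-1)` as a set of
exponents). -/
def gι (γ : ℚ × ℚ) : ℂ := (γ.1 : ℂ) + (γ.2 : ℂ) * I

/-- The value `Σ_γ f(γ)·e^{γ}` of a LACUNARY LINEAR FORM in exponentials: `f` is a finitely supported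
function exponent ↦ integer coefficient (so the exponents `γ ∈ 𝕀` are pairwise DIFFERENT by construction). -/
def lacEval (f : ℚ × ℚ →₀ ℤ) : ℂ := ∑ γ ∈ f.support, (f γ : ℂ) * cexp (gι γ)

/-- The size of a lacunary form relative to a common denominator `d` of its exponents:
`2 + d + Σ_γ (|Re γ| + |Im γ| + |f γ|)` (it dominates EHLM's `g₁ ≤ d`, `g₃`, `g₂ ≤ g₁(1+g₃)`, `g₄ ≤ g₂` and
every height `h_i`). -/
def lacSize (f : ℚ × ℚ →₀ ℤ) (d : ℕ) : ℝ :=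
  2 + (d : ℝ) + ∑ γ ∈ f.support, (|(γ.1 : ℝ)| + |(γ.2 : ℝ)| + |(f γ : ℝ)|)

/-- **Registered fact `hE` — [EHLM2015, Theorem 2.1] at `𝕀 = ℚ(√-1)`, in an existential-exponent WEAK form.**
A.-M. Ernvall-Hytönen, K. Leppälä, T. Matala-aho, *An explicit Baker type lower bound of exponential values*,
Proc. Roy. Soc. Edinburgh Sect. A **145** (2015) 1153–1182, doi:10.1017/S0308210515000049 (= arXiv:1309.6053);
ledger bib key `ErnvallhytonenLeppalaMatalaaho2013`.  All page/line refs below are to the materialised arXiv text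
[corpus: paper:arxiv-1309.6053 pNNNN].

THE PRINT STATEMENT (p0004 L5–L94).  Setup (L5–L6): `𝕀 = ℚ` or an imaginary quadratic field, `ℤ_𝕀` its ring
of integers; `α_j = x_j/y_j ∈ 𝕀 (j = 0, …, m)` are `m+1` DIFFERENT numbers, `x_j ∈ ℤ_𝕀`, `y_j ∈ ℤ⁺`,
`gcd(x_j,y_j) = 1`; `g₁ = lcm(y₀,…,y_m)`, `g₂ = max_j (|x_j|+|y_j|)`, `g₃ = max_j |α_j|`,
`g₄ = max_{j≥1}(1+|y_j|/|x_j|)` (L11–L17), with (2.1) `2 ≤ g₂`, `max{g₄,1+g₃} ≤ g₂ ≤ g₁(1+g₃)`, `g₁ ≤ g₂^m`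
(L23) for `ᾱ = (0,α₁,…,α_m)` (L26); `b₀ = √(log g₂) + log g₄/(2√(log g₂))`, `e₀ = 3√(log g₂) + log g₄/(2√(log g₂))`
(L30–L31), `b₁ = max{0, log g₁ − log g₂ − log g₄}`, `e₁ = max{0, log g₁ + 2 log(1+g₃) + 2 log 2 + 1 − log g₂ − log g₄}`
(L36–L38); `A = b₀+e₀m`, `B = 1+b₀+b₁+e₁m`, `C = m`, `D = b₀m+e₀m²`, `E = (1+b₀+b₁)m+(2e₀+e₁)m²` (L42–L44);
`z` = the inverse of `y(z) = z log z (z ≥ e)` and `ξ(z,H) = A(2z(2 log H)/log H)^{1/2} + B·z(2 log H)/log H +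
C·log z(2 log H)/log H + D·(log z(2 log H))^{1/2}/log H` (L46–L58); `H₀ = max{e^{(γ log γ)/2}, 2 log(s_𝕀/t_𝕀)}`,
`log γ = (3me₀)²` (L62–L64), `s_𝕀, t_𝕀` the Siegel-lemma constants of the FIELD (L67; Lemma 3.1, p0006 L7–L34).
THEOREM 2.1 (L71–L94): «Let `m ≥ 2`.  With `α₀ = 0` and the notations above,
`|β₀ + β₁e^{α₁} + … + β_m e^{α_m}| > 1/(2e^E H^{1+ε(H)})` for all `β̄ = (β₀,…,β_m) ∈ ℤ_𝕀^{m+1} ∖ {0̄}` and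
`H = ∏_{i=1}^m (2mH_i) ≥ H₀`, `H_i ≥ h_i = max{1,|β_i|}`, with the error term `ε(H) = ξ(z,H)`.»  Example 2.8
(p0005 L167–L186) is the case `𝕀 = ℚ(√-1)`, `ℤ_𝕀 = ℤ[√-1]`, the one used here.  (Lineage quoted ibid. p0003:
Baker 1965 over `ℚ`; Mahler 1975, Sankilampi 2009 explicit.)

THE TYPED WEAK FORM AND ITS DERIVATION FROM THEOREM 2.1, LINE BY LINE (a CONSEQUENCE of the print statement —
never stronger; the exponent `κ = κ(m)` is existential, no explicit constant of the paper is asserted).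
Data: `f : ℚ × ℚ →₀ ℤ` non-zero with `#supp f ≤ m+1`, and `d > 0` with `dγ ∈ ℤ × ℤ` for every `γ ∈ supp f`;
`γ = (γ.1, γ.2) ∈ ℚ × ℚ` is READ as the element `γ.1 + iγ.2` of `𝕀 = ℚ(i)` (`gι`), so `Λ := lacEval f =
Σ_{γ ∈ supp f} f(γ)e^{γ.1+iγ.2}` and `B := lacSize f d = 2 + d + Σ_{γ ∈ supp f}(|γ.1|+|γ.2|+|f γ|) ≥ 2`.
Claim: `|Λ| ≥ exp(−B^κ)`.
 (i) One term (`supp f = {γ}`): `|Λ| = |f γ|·e^{Re γ} ≥ e^{−|γ.1|} ≥ e^{−B} ≥ exp(−B^κ)` for any `κ ≥ 1`.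
 (ii) `s := #supp f ≥ 2`.  Fix `γ₀ ∈ supp f` and write `Λ = e^{γ₀}·Λ'`, `Λ' = Σ_γ f(γ)e^{γ−γ₀}`,
     `|e^{γ₀}| = e^{Re γ₀} ≥ e^{−B}`.  NORMALISATION `α₀ = 0`: the exponents `α = γ − γ₀` (`γ ∈ supp f`) are `s`
     DIFFERENT elements of `𝕀` containing `0` (distinctness is automatic: `supp f` is a `Finset`).  PADDING to
     `m' + 1` terms with `m' := max(m,2) ≥ 2`: adjoin `m'+1−s` further exponents from `{1,…,m'+1} ⊂ ℤ ⊂ 𝕀` not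
     already among the `α`'s (possible: at most `s−1` of these integers are taken), with coefficient `β = 0`
     (allowed: Theorem 2.1 only requires the VECTOR `β̄ ≠ 0̄`, and `h_i = max{1,|β_i|} = 1` there); the genuine
     coefficients are `β = f(γ) ∈ ℤ ∖ {0} ⊂ ℤ[i] = ℤ_𝕀`, so `β̄ ≠ 0̄`.  PARAMETERS (representation, fixed at port per the critic's
     VERDICT L2040): `y_j` := the least positive integer with `y_jα_j ∈ ℤ[i]`, `x_j := y_jα_j` (then
     `gcd_ℤ(Re x_j, Im x_j, y_j) = 1` — the only reading of `gcd(x_j, y_j) = 1` uniformly meaningful for the paper's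
     `ℤ_𝕀`; e.g. `(1+i)/2 = 1/(1−i)` admits no ideal-coprime representation with a positive-integer denominator);
     the proof of Theorem 2.1 uses the representation only through `x_j = y_jα_j ∈ ℤ_𝕀` and the sizes `|x_j|`, `|y_j|`,
     `g₁^L·A_{0,j}(t) ∈ ℤ_𝕀[t]` (p0007 L40–L57, p0008 L70–L118, p0009 L30–L93), so the bound holds for this
     representation with the `g_i` computed from it; every such `y_j` divides `d`, so `g₁ ≤ d ≤ B`; `g₃ ≤ max(max_γ|γ−γ₀|, m'+1) ≤ B + m' + 1`; by (2.1)
     `2 ≤ g₂ ≤ g₁(1+g₃) ≤ B(B+m'+2)` and `g₄ ≤ g₂`; `h_i ≤ B`.  CHOICE OF HEIGHTS: `H_i := max(h_i, H₀)` — allowed,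
     since the theorem quantifies over ALL `H_i ≥ h_i` subject only to `H = ∏(2m'H_i) ≥ H₀`, which holds because
     `H ≥ 2m'H₁ ≥ H₀`; no hidden «`H ≥ H₀`» side condition remains.  BOUNDS (fixed `m'`, constants `c = c(m')`):
     `g₄ ≤ g₂` and `log g₂ ≥ log 2` give `b₀ ≤ 1.5√(log g₂)`, `e₀ ≤ 3.5√(log g₂)`, `b₁, e₁ ≤ log g₁ + 2 log(1+g₃) + 3`,
     hence `A, B, C, D, E ≤ c(1 + log B)`; `log γ = (3m'e₀)² ≤ 110.25 m'² log g₂`, so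
     `log H₀ ≤ max{½ γ log γ, log(2 log(s_𝕀/t_𝕀))} ≤ c·B^{220.5m'²+2}` (`g₂ ≤ (m'+3)B²`; the Siegel term is a constant of
     the FIXED field `ℚ(i)`); `log H = Σ_i log(2m'H_i) ≤ m'(log 2m' + log B + log H₀) ≤ c·B^{220.5m'²+2}`; and since
     `z(w) log z(w) = w` with `z(w) ≥ e` forces `z(w) ≤ w`, `ε(H) = ξ(z,H) ≤ 2A + 2B + C + D ≤ c(1 + log B)`
     (using `log(2 log H) ≤ log H`, valid as `log H ≥ 1`).  CONCLUSION: Theorem 2.1 gives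
     `−log|Λ'| < log 2 + E + (1+ε(H)) log H ≤ c·B^{220.5m'²+3}`, so `−log|Λ| ≤ B + c·B^{220.5m'²+3} ≤ B^κ` for
     `κ := ⌈220.5m'² + 4 + log₂ c⌉ + 1` (as `B ≥ 2`; exponent bookkeeping `+1 → +2` amended at port per VERDICT L2040 —
     `½γ·log γ` with `γ ≤ g₂^{110.25m'²}` — no effect, `κ` is existential).
No loophole: `f ≠ 0` is a hypothesis; distinct exponents come from `Finsupp`; coefficients are rational integers
(a SUBCASE of `ℤ_𝕀`); the common denominator `d` only enters through `B`; `hE` is the ONLY `def … : Prop` binder of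
this file and is used solely as the hypothesis `(hE : EHLM2015_thm_2_1)` (an unproved-in-tree published theorem).
[cite arXiv:1309.6053 Thm 2.1; doi:10.1017/S0308210515000049; bib ErnvallhytonenLeppalaMatalaaho2013] -/
def EHLM2015_thm_2_1 : Prop :=
  ∀ m : ℕ, ∃ κ : ℕ, ∀ (f : ℚ × ℚ →₀ ℤ) (d : ℕ), f ≠ 0 → f.support.card ≤ m + 1 → 0 < d →
    (∀ γ ∈ f.support, (∃ z : ℤ, (d : ℚ) * γ.1 = z) ∧ (∃ z : ℤ, (d : ℚ) * γ.2 = z)) →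
    Real.exp (-(lacSize f d) ^ κ) ≤ ‖lacEval f‖

/-! ## §2  The collapse: data -/

variable {n : ℕ}

/-- The tuple `(x, e^{w₁x^{e₁}}, …, e^{w_n x^{e_n}})` with Gaussian-rational `w_l` and exponents `e_l ∈ ℕ`. -/
def gaussPt (w : Fin n → ℚ × ℚ) (e : Fin n → ℕ) (x : ℂ) : Fin (n + 1) → ℂ :=
  Fin.cons x fun l => cexp (gι (w l) * x ^ (e l))

/-- Coordinate `0` of the Gauss-curve point is the parameter `x`. -/
@[simp] theorem gaussPt_zero (w : Fin n → ℚ × ℚ) (e : Fin n → ℕ) (x : ℂ) : gaussPt w e x 0 = x := by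
  simp [gaussPt]

/-- Coordinate `l.succ` of the Gauss-curve point is `exp(gι(w_l)·x^{e_l})`. -/
@[simp] theorem gaussPt_succ (w : Fin n → ℚ × ℚ) (e : Fin n → ℕ) (x : ℂ) (l : Fin n) :
    gaussPt w e x l.succ = cexp (gι (w l) * x ^ (e l)) := by
  simp [gaussPt]

/-- The exponent of the collapsed monomial `s` at the rational point `r`:
`Σ_l s_{l+1}·w_l·r^{e_l} ∈ ℚ(i)`, as a pair (real part, imaginary part). -/
def expo (w : Fin n → ℚ × ℚ) (e : Fin n → ℕ) (r : ℚ) (s : Fin (n + 1) →₀ ℕ) : ℚ × ℚ :=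
  (∑ l : Fin n, (s l.succ : ℚ) * (w l).1 * r ^ (e l), ∑ l : Fin n, (s l.succ : ℚ) * (w l).2 * r ^ (e l))

/-- The integer coefficient `coeff_s · num(r)^{s₀} · den(r)^{D-s₀}` (`= den(r)^D · coeff_s · r^{s₀}`). -/
def coef (P : MvPolynomial (Fin (n + 1)) ℤ) (D : ℕ) (r : ℚ) (s : Fin (n + 1) →₀ ℕ) : ℤ :=
  P.coeff s * r.num ^ (s 0) * (r.den : ℤ) ^ (D - s 0)

/-- **The lacunary form** `Λ_r = Σ_{s ∈ supp P} coef_s · [e^{expo_s}]` — terms with equal exponents MERGE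
(Finsupp addition), so its support has at most `#supp P` elements whatever `r` is. -/
def lacForm (P : MvPolynomial (Fin (n + 1)) ℤ) (D : ℕ) (w : Fin n → ℚ × ℚ) (e : Fin n → ℕ) (r : ℚ) :
    ℚ × ℚ →₀ ℤ :=
  ∑ s ∈ P.support, Finsupp.single (expo w e r s) (coef P D r s)

/-- The entire function `F(x) = P(x, e^{w_l x^{e_l}})` along the reals, written as an exponential sum. -/
def FG (P : MvPolynomial (Fin (n + 1)) ℤ) (w : Fin n → ℚ × ℚ) (e : Fin n → ℕ) (x : ℝ) : ℂ :=
  ∑ s ∈ P.support, ((MvPolynomial.coeff s P : ℤ) : ℂ) * (x : ℂ) ^ (s 0) *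
    cexp (∑ l : Fin n, (s l.succ : ℂ) * (gι (w l) * (x : ℂ) ^ (e l)))

/-! ## §3  The collapse: identities -/

/-- The collapsed exponent `expo w e r s`, read in `ℂ`, is `Σ_l s_{l+1}·gι(w_l)·r^{e_l}`. -/
theorem gι_expo (w : Fin n → ℚ × ℚ) (e : Fin n → ℕ) (r : ℚ) (s : Fin (n + 1) →₀ ℕ) :
    gι (expo w e r s) = ∑ l : Fin n, (s l.succ : ℂ) * (gι (w l) * (r : ℂ) ^ (e l)) := by
  have h : ∀ l : Fin n, (s l.succ : ℂ) * (gι (w l) * (r : ℂ) ^ (e l)) =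
      (s l.succ : ℂ) * ((w l).1 : ℂ) * (r : ℂ) ^ (e l) + ((s l.succ : ℂ) * ((w l).2 : ℂ) * (r : ℂ) ^ (e l)) * I := by
    intro l; simp only [gι]; ring
  rw [Finset.sum_congr rfl fun l _ => h l, Finset.sum_add_distrib, ← Finset.sum_mul]
  simp only [gι, expo]
  push_cast
  rfl

/-- `FG P w e x` is the evaluation of `P` at the Gauss-curve point with parameter `x`. -/
theorem FG_eq_aeval (P : MvPolynomial (Fin (n + 1)) ℤ) (w : Fin n → ℚ × ℚ) (e : Fin n → ℕ) (x : ℝ) :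
    FG P w e x = MvPolynomial.aeval (gaussPt w e (x : ℂ)) P := by
  rw [MvPolynomial.aeval_def, MvPolynomial.eval₂_eq', FG]
  refine Finset.sum_congr rfl fun s _ => ?_
  rw [Fin.prod_univ_succ]
  simp only [algebraMap_int_eq, eq_intCast, gaussPt_zero, gaussPt_succ]
  have hprod : ∏ l : Fin n, cexp (gι (w l) * (x : ℂ) ^ (e l)) ^ (s l.succ) =
      cexp (∑ l : Fin n, (s l.succ : ℂ) * (gι (w l) * (x : ℂ) ^ (e l))) := by
    rw [Complex.exp_sum]
    exact Finset.prod_congr rfl fun l _ => by rw [← Complex.exp_nat_mul]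
  rw [hprod]
  ring

/-- `lacEval` is the `Finsupp.sum` of the additive kernel `γ c ↦ c·e^γ`. -/
theorem lacEval_eq_sum (f : ℚ × ℚ →₀ ℤ) : lacEval f = f.sum fun γ c => (c : ℂ) * cexp (gι γ) := rfl

/-- The cleared coefficient `coef`, cast to `ℂ`: `den(r)^D · P_s · r^{s 0}`. -/
theorem coef_cast (P : MvPolynomial (Fin (n + 1)) ℤ) {D : ℕ} {r : ℚ} {s : Fin (n + 1) →₀ ℕ}
    (hs : s 0 ≤ D) :
    (coef P D r s : ℂ) = (r.den : ℂ) ^ D * (((MvPolynomial.coeff s P : ℤ) : ℂ) * (r : ℂ) ^ (s 0)) := by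
  have hden : (r.den : ℂ) ≠ 0 := by exact_mod_cast r.den_nz
  have hr : (r : ℂ) = (r.num : ℂ) / (r.den : ℂ) := by
    rw [← Complex.ofReal_ratCast, Rat.cast_def]; push_cast; rfl
  have hsplit : (r.den : ℂ) ^ D = (r.den : ℂ) ^ (s 0) * (r.den : ℂ) ^ (D - s 0) := by
    rw [← pow_add, Nat.add_sub_cancel' hs]
  simp only [coef, Int.cast_mul, Int.cast_pow, Int.cast_natCast]
  rw [hr, hsplit, div_pow]
  field_simp

/-- **The collapse identity** `Λ_r = den(r)^D · F(r)`. -/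
theorem lacEval_lacForm (P : MvPolynomial (Fin (n + 1)) ℤ) {D : ℕ} (hD : ∀ s ∈ P.support, s 0 ≤ D)
    (w : Fin n → ℚ × ℚ) (e : Fin n → ℕ) (r : ℚ) :
    lacEval (lacForm P D w e r) = (r.den : ℂ) ^ D * FG P w e (r : ℝ) := by
  rw [lacEval_eq_sum, lacForm, ← Finsupp.sum_finsetSum_index (by simp) (by intros; push_cast; ring)]
  rw [FG, Finset.mul_sum]
  refine Finset.sum_congr rfl fun s hs => ?_
  rw [Finsupp.sum_single_index (by simp), coef_cast P (hD s hs), gι_expo]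
  push_cast
  ring

/-! ## §4  The upper bound: `F` is `C¹` along the reals, hence locally Lipschitz at its zero `T` -/

/-- `FG P w e` is `C¹` along the reals. -/
theorem contDiff_FG (P : MvPolynomial (Fin (n + 1)) ℤ) (w : Fin n → ℚ × ℚ) (e : Fin n → ℕ) :
    ContDiff ℝ 1 (FG P w e) := by
  unfold FG
  have hx : ContDiff ℝ 1 (fun x : ℝ => (x : ℂ)) := Complex.ofRealCLM.contDiff
  refine ContDiff.sum fun s _ => ?_
  exact (contDiff_const.mul (hx.pow _)).mul
    (Complex.contDiff_exp.comp (ContDiff.sum fun l _ => contDiff_const.mul (contDiff_const.mul (hx.pow _))))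

/-- Local Lipschitz bound for `FG P w e` at `T`: `|FG x − FG T| ≤ K|x − T|` for `|x − T| < δ₁`. -/
theorem exists_lipschitz_FG (P : MvPolynomial (Fin (n + 1)) ℤ) (w : Fin n → ℚ × ℚ) (e : Fin n → ℕ)
    (T : ℝ) : ∃ K δ₁ : ℝ, 0 ≤ K ∧ 0 < δ₁ ∧
      ∀ x : ℝ, |x - T| < δ₁ → ‖FG P w e x - FG P w e T‖ ≤ K * |x - T| := by
  obtain ⟨K, t, ht, hK⟩ := ((contDiff_FG P w e).contDiffAt (x := T)).exists_lipschitzOnWith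
  obtain ⟨δ₁, hδ₁, hball⟩ := Metric.mem_nhds_iff.mp ht
  refine ⟨K, δ₁, K.2, hδ₁, fun x hx => ?_⟩
  have hxt : x ∈ t := hball (by rw [Metric.mem_ball, Real.dist_eq]; exact hx)
  have hTt : T ∈ t := hball (Metric.mem_ball_self hδ₁)
  have := (lipschitzOnWith_iff_dist_le_mul.mp hK) x hxt T hTt
  rwa [dist_eq_norm, Real.dist_eq] at this

/-! ## §5  Distinct exponents and a non-zero coefficient, for `r` near `T` -/

/-- The exponential part `(s₁, …, s_n)` of a monomial exponent `s = (s₀; s₁, …, s_n)`. -/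
def tail (s : Fin (n + 1) →₀ ℕ) : Fin n → ℕ := fun l => s l.succ

/-- The collapsed exponent only depends on the tail of the multi-index. -/
theorem expo_eq_of_tail_eq (w : Fin n → ℚ × ℚ) (e : Fin n → ℕ) (r : ℚ) {s s' : Fin (n + 1) →₀ ℕ}
    (h : tail s = tail s') : expo w e r s = expo w e r s' := by
  have hl : ∀ l : Fin n, s l.succ = s' l.succ := fun l => congrFun h l
  simp only [expo, hl]

/-- A multi-index on `Fin (n+1)` is determined by its tail and its `0`-th entry. -/
theorem eq_of_tail_eq_of_zero_eq {s s' : Fin (n + 1) →₀ ℕ} (ht : tail s = tail s') (h0 : s 0 = s' 0) :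
    s = s' := by
  ext i
  refine Fin.cases h0 (fun l => ?_) i
  exact congrFun ht l

/-- The DIFFERENCE POLYNOMIAL of two exponential parts: `Σ_l (t_l − t'_l)·w_l·X^{e_l} ∈ ℂ[X]`. -/
def diffPoly (w : Fin n → ℚ × ℚ) (e : Fin n → ℕ) (t t' : Fin n → ℕ) : ℂ[X] :=
  ∑ l : Fin n, ((t l : ℤ) - (t' l : ℤ)) • Polynomial.monomial (e l) (gι (w l))

/-- Under the FREENESS hypothesis (the `w_l X^{e_l}` are `ℤ`-linearly independent in `ℂ[X]`), different
exponential parts have a NON-ZERO difference polynomial. -/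
theorem diffPoly_ne_zero {w : Fin n → ℚ × ℚ} {e : Fin n → ℕ}
    (hLI : LinearIndependent ℤ (fun l : Fin n => Polynomial.monomial (e l) (gι (w l))))
    {t t' : Fin n → ℕ} (h : t ≠ t') : diffPoly w e t t' ≠ 0 := by
  intro h0
  apply h
  funext l
  have := (Fintype.linearIndependent_iff.mp hLI) (fun l => (t l : ℤ) - (t' l : ℤ)) h0 l
  have : (t l : ℤ) = (t' l : ℤ) := sub_eq_zero.mp this
  exact_mod_cast this

/-- Evaluation of the difference polynomial `diffPoly w e t t'` at `x`. -/
theorem eval_diffPoly (w : Fin n → ℚ × ℚ) (e : Fin n → ℕ) (t t' : Fin n → ℕ) (x : ℂ) :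
    (diffPoly w e t t').eval x = ∑ l : Fin n, (((t l : ℤ) - (t' l : ℤ) : ℤ) : ℂ) * (gι (w l) * x ^ (e l)) := by
  simp only [diffPoly, Polynomial.eval_finsetSum, Polynomial.eval_smul, Polynomial.eval_monomial]
  simp only [zsmul_eq_mul]

/-- The difference of two collapsed exponents is the difference polynomial evaluated at `r`. -/
theorem gι_expo_sub (w : Fin n → ℚ × ℚ) (e : Fin n → ℕ) (r : ℚ) (s s' : Fin (n + 1) →₀ ℕ) :
    gι (expo w e r s) - gι (expo w e r s') = (diffPoly w e (tail s) (tail s')).eval (r : ℂ) := by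
  rw [eval_diffPoly, gι_expo, gι_expo, ← Finset.sum_sub_distrib]
  refine Finset.sum_congr rfl fun l _ => ?_
  simp only [tail]; push_cast; ring

/-- `gι : ℚ × ℚ → ℂ`, `(a, b) ↦ a + bi`, is injective. -/
theorem gι_injective : Function.Injective (gι : ℚ × ℚ → ℂ) := by
  intro a b h
  have h1 := congrArg Complex.re h
  have h2 := congrArg Complex.im h
  simp [gι] at h1 h2
  exact Prod.ext (by exact_mod_cast h1) (by exact_mod_cast h2)

/-- If the difference polynomial does not vanish at `r`, the two collapsed exponents differ. -/
theorem tail_eq_of_expo_eq {w : Fin n → ℚ × ℚ} {e : Fin n → ℕ} {r : ℚ} {s s' : Fin (n + 1) →₀ ℕ}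
    (hne : tail s ≠ tail s' → (diffPoly w e (tail s) (tail s')).eval (r : ℂ) ≠ 0)
    (h : expo w e r s = expo w e r s') : tail s = tail s' := by
  by_contra ht
  apply hne ht
  rw [← gι_expo_sub, h, sub_self]

/-- The FIBRE POLYNOMIAL of an exponential part `t`: `Σ_{s ∈ supp P, tail s = t} coeff_s · X^{s₀} ∈ ℤ[X]`. -/
def fib (P : MvPolynomial (Fin (n + 1)) ℤ) (t : Fin n → ℕ) : ℤ[X] :=
  ∑ s ∈ P.support with tail s = t, Polynomial.C (MvPolynomial.coeff s P) * X ^ (s 0)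

/-- The fibre polynomial of `P` over the tail of a support element is non-zero. -/
theorem fib_ne_zero (P : MvPolynomial (Fin (n + 1)) ℤ) {s₀ : Fin (n + 1) →₀ ℕ} (hs₀ : s₀ ∈ P.support) :
    fib P (tail s₀) ≠ 0 := by
  intro h0
  have hc := congrArg (fun p : ℤ[X] => p.coeff (s₀ 0)) h0
  simp only [fib, Polynomial.finsetSum_coeff, Polynomial.coeff_C_mul_X_pow, Polynomial.coeff_zero] at hc
  rw [Finset.sum_eq_single s₀] at hc
  · simp only [if_true] at hc
    exact (MvPolynomial.mem_support_iff.mp hs₀) hc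
  · intro s hs hne
    rw [if_neg]
    intro h00
    exact hne (eq_of_tail_eq_of_zero_eq (Finset.mem_filter.mp hs).2 h00.symm)
  · intro h
    exact (h (Finset.mem_filter.mpr ⟨hs₀, rfl⟩)).elim

/-- The sum of the cleared coefficients over a tail fibre, cast to `ℂ`, is `den(r)^D · (fib P t).eval r`. -/
theorem sum_coef_fibre_cast (P : MvPolynomial (Fin (n + 1)) ℤ) {D : ℕ} (hD : ∀ s ∈ P.support, s 0 ≤ D)
    (r : ℚ) (t : Fin n → ℕ) :
    ((∑ s ∈ P.support with tail s = t, coef P D r s : ℤ) : ℂ) =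
      (r.den : ℂ) ^ D * Polynomial.aeval (r : ℂ) (fib P t) := by
  rw [fib, map_sum, Finset.mul_sum]
  push_cast
  refine Finset.sum_congr rfl fun s hs => ?_
  rw [coef_cast P (hD s (Finset.mem_filter.mp hs).1), map_mul, map_pow, Polynomial.aeval_C,
    Polynomial.aeval_X, algebraMap_int_eq, eq_intCast]

/-- The merged coefficient of `Λ_r` at the exponent of `s₀` is the fibre sum (when the exponents of different
exponential parts are distinct at `r`). -/
theorem lacForm_apply_expo (P : MvPolynomial (Fin (n + 1)) ℤ) (D : ℕ) {w : Fin n → ℚ × ℚ} {e : Fin n → ℕ}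
    {r : ℚ} (hdist : ∀ s ∈ P.support, ∀ s' ∈ P.support, expo w e r s = expo w e r s' → tail s = tail s')
    {s₀ : Fin (n + 1) →₀ ℕ} (hs₀ : s₀ ∈ P.support) :
    lacForm P D w e r (expo w e r s₀) = ∑ s ∈ P.support with tail s = tail s₀, coef P D r s := by
  rw [lacForm, Finsupp.finsetSum_apply, Finset.sum_filter]
  refine Finset.sum_congr rfl fun s hs => ?_
  rw [Finsupp.single_apply]
  by_cases h : tail s = tail s₀
  · rw [if_pos (expo_eq_of_tail_eq w e r h), if_pos h]
  · rw [if_neg (fun h' => h (hdist s hs s₀ hs₀ h')), if_neg h]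

/-- The support of the lacunary form lies in the image of `P.support` under `expo`. -/
theorem support_lacForm_subset (P : MvPolynomial (Fin (n + 1)) ℤ) (D : ℕ) (w : Fin n → ℚ × ℚ)
    (e : Fin n → ℕ) (r : ℚ) : (lacForm P D w e r).support ⊆ P.support.image (expo w e r) := by
  classical
  refine (Finsupp.support_finsetSum).trans ?_
  intro γ hγ
  obtain ⟨s, hs, hγs⟩ := Finset.mem_biUnion.mp hγ
  have := Finsupp.support_single_subset hγs
  rw [Finset.mem_singleton] at this
  exact Finset.mem_image.mpr ⟨s, hs, this.symm⟩

/-- TERM COUNT: the lacunary form has at most `#P.support` terms (independent of `r`). -/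
theorem card_support_lacForm_le (P : MvPolynomial (Fin (n + 1)) ℤ) (D : ℕ) (w : Fin n → ℚ × ℚ)
    (e : Fin n → ℕ) (r : ℚ) : (lacForm P D w e r).support.card ≤ P.support.card := by
  classical
  exact (Finset.card_le_card (support_lacForm_subset P D w e r)).trans Finset.card_image_le

end Summit.Schanuel.Schanuel.Theorems.RootDecomp1EUntwistedWall
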